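import Summits.AtomisticToContinuum.Crystallization.Theorems.FrustratedLawDichotomyHalfSpaceColumn

/-!
# FrustratedLawDichotomy · crux `AperiodicFrustratedLawGap` (stmt-AtomisticToContinuum-27623) — the half-space force column for INFINITE configurations
# (hdef side, row class H near class-D boundaries; companion of `…HalfSpaceColumn`; decomp-a2c, prover hand 1, gen 51)

`…HalfSpaceColumn.sum_norm_force_le_of_separated_halfspace_sevenTenths` bounds the Lennard-Jones force exerted on `x` by a FINITE `7/10`-separated set
lying beyond a plane at signed distance `d` from `x` by the explicit column `TH(d)`.  The actual configurations of the crux are infinite separated sets;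
this file passes to `tsum`:

* `summable_force_of_halfspace` — the force series over a `δ`-separated half-space configuration is summable (all points are `≥ d` from `x`, so
  `…FarForceColumn.summable_force_of_far_sharp` applies);
* ★ `norm_tsum_force_le_of_halfspace_sevenTenths` — `‖Σ'_{y ∈ Y} ((dist x y)⁻¹^8 − (dist x y)⁻¹^14) • (x − y)‖ ≤ TH(d)` for a `7/10`-separated `Y` beyond the
  plane (`tsum_le_of_sum_le` on the finite columns).

DEF-FREE; imports the tree's `…HalfSpaceColumn` only; 0 sorry.  [folklore]
-/

noncomputable section

namespace Summit.AtomisticToContinuum.Crystallization.Theorems.FrustratedLawDichotomyHalfSpaceColumnInfinite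

open scoped BigOperators RealInnerProductSpace
open Summit.AtomisticToContinuum.Crystallization.Theorems.FrustratedLawDichotomyFarForceColumn (summable_force_of_far_sharp)
open Summit.AtomisticToContinuum.Crystallization.Theorems.FrustratedLawDichotomyHalfSpaceColumn (sum_norm_force_le_of_separated_halfspace_sevenTenths)

/-! ## Infinite separated configurations in a half-space (`tsum`) -/

/-- **Summability of the force over a separated half-space configuration**: for a `δ`-separated `Y ⊆ ℝ³` lying beyond the plane at signed
distance `d ≥ δ/2`, `d > 0` from `x` in the unit direction `e`, the force series `Σ_{y ∈ Y} ((dist x y)⁻¹^8 − (dist x y)⁻¹^14) • (x − y)` is summable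
(every point is at distance `≥ d` from `x`, so `…FarForceColumn.summable_force_of_far_sharp` applies). [folklore] -/
theorem summable_force_of_halfspace {δ : ℝ} {Y : Set (EuclideanSpace ℝ (Fin 3))} (hδ : 0 < δ)
    (hsep : ∀ a ∈ Y, ∀ b ∈ Y, a ≠ b → δ ≤ dist a b) (x e : EuclideanSpace ℝ (Fin 3)) (he : ‖e‖ = 1) {d : ℝ} (hd2 : δ / 2 ≤ d)
    (hhalf : ∀ y ∈ Y, d ≤ ⟪y - x, e⟫) :
    Summable fun y : ↥Y => ((dist x y)⁻¹ ^ 8 - (dist x y)⁻¹ ^ 14) • (x - (y : EuclideanSpace ℝ (Fin 3))) := by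
  have hfar : ∀ y ∈ Y, d ≤ dist y x := fun y hy => by
    rw [dist_eq_norm]
    have h1 := hhalf y hy
    have h2 : ⟪y - x, e⟫ ≤ ‖y - x‖ * ‖e‖ := real_inner_le_norm _ _
    rw [he, mul_one] at h2
    linarith
  exact summable_force_of_far_sharp hδ hsep x hd2 hfar

/-- ★ **HALF-SPACE FORCE COLUMN, infinite form at separation `7/10`.**  For a `7/10`-separated `Y ⊆ ℝ³` lying beyond the plane at signed distance
`d ≥ 7/20` from `x` in the unit direction `e` (`d ≤ ⟪y − x, e⟫` for all `y ∈ Y`),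
`‖Σ'_{y ∈ Y} ((dist x y)⁻¹^8 − (dist x y)⁻¹^14) • (x − y)‖ ≤ TH(d)` with the polynomial `TH` of `sum_norm_force_le_of_separated_halfspace_sevenTenths`
(finite columns are uniformly bounded; `tsum_le_of_sum_le`).  This is the form the class-D halo rows consume for the actual (infinite) configuration. [folklore] -/
theorem norm_tsum_force_le_of_halfspace_sevenTenths {Y : Set (EuclideanSpace ℝ (Fin 3))}
    (hsep : ∀ a ∈ Y, ∀ b ∈ Y, a ≠ b → (7 : ℝ) / 10 ≤ dist a b) (x e : EuclideanSpace ℝ (Fin 3)) (he : ‖e‖ = 1) {d : ℝ} (hd : 7 / 20 ≤ d)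
    (hhalf : ∀ y ∈ Y, d ≤ ⟪y - x, e⟫) :
    ‖∑' y : ↥Y, ((dist x y)⁻¹ ^ 8 - (dist x y)⁻¹ ^ 14) • (x - (y : EuclideanSpace ℝ (Fin 3)))‖ ≤
      6000 / 343 * (7 * (d⁻¹ ^ 4 / 4 + (7 / 5 - d) * d⁻¹ ^ 5 / 5 + (49 / 100 - d ^ 2) * d⁻¹ ^ 6 / 6 + (7 / 10 - d) ^ 2 * d * d⁻¹ ^ 7 / 7) +
        13 * (d⁻¹ ^ 10 / 10 + (7 / 5 - d) * d⁻¹ ^ 11 / 11 + (49 / 100 - d ^ 2) * d⁻¹ ^ 12 / 12 + (7 / 10 - d) ^ 2 * d * d⁻¹ ^ 13 / 13)) := by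
  classical
  have hsum := summable_force_of_halfspace (by norm_num : (0:ℝ) < 7 / 10) hsep x e he (by linarith) hhalf
  have hnorm : Summable fun y : ↥Y => ‖((dist x y)⁻¹ ^ 8 - (dist x y)⁻¹ ^ 14) • (x - (y : EuclideanSpace ℝ (Fin 3)))‖ :=
    hsum.norm
  refine (norm_tsum_le_tsum_norm hnorm).trans (hnorm.tsum_le_of_sum_le fun u => ?_)
  set u' : Finset (EuclideanSpace ℝ (Fin 3)) := u.image Subtype.val with hu'
  have hmem : ∀ y ∈ u', y ∈ Y := fun y hy => by
    rw [hu', Finset.mem_image] at hy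
    obtain ⟨w, -, rfl⟩ := hy
    exact w.2
  have hsum_eq : ∑ y ∈ u, ‖((dist x y)⁻¹ ^ 8 - (dist x y)⁻¹ ^ 14) • (x - (y : EuclideanSpace ℝ (Fin 3)))‖ =
      ∑ y ∈ u', ‖((dist x y)⁻¹ ^ 8 - (dist x y)⁻¹ ^ 14) • (x - y)‖ := by
    rw [hu', Finset.sum_image (fun a _ b _ h => Subtype.ext h)]
  rw [hsum_eq]
  exact sum_norm_force_le_of_separated_halfspace_sevenTenths u' x e he hd
    (fun a ha b hb hab => hsep a (hmem a ha) b (hmem b hb) hab) fun y hy => hhalf y (hmem y hy)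

end Summit.AtomisticToContinuum.Crystallization.Theorems.FrustratedLawDichotomyHalfSpaceColumnInfinite

end
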